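import Mathlib
import Summits.Parity.GeneralizedHardyLittlewood.Theorems.FordMaynardSieveConst01651SieveConst01651TypeIIBilin

/-!
# Route `FordMaynardSieveConst01651`, target `SieveConst01651` (stmt-Parity-19185), line `sieve_decomposition`:
# helpers towards `stub_typeIIRegion` — row (and column) `ℓ¹` masses of a bilinearly bounded kernel

A bilinear bound with ARBITRARY `1`-bounded coefficients controls the `ℓ¹` mass of every single row and column
of the kernel: take `a = 𝟙_{w₀}` and `b = \overline{sign} K(w₀, ·)`.  For Ford–Maynard's Type-II information (II)
at `θ = 0` this says: for every single modulus `1 < m ≤ x^ν`,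
`∑_{x/2 < mn ≤ x} |w(mn)| ≤ x/(log x)^B` — the `|w|`-mass on the multiples of any ONE small modulus is negligible,
with NO lower bound on `w` (contrast `…TypeIIDiscard`, which needs `w ≥ -M` but handles `x^ν` moduli at once).
Use: discarding exceptional sets cut out by boundedly many small moduli (e.g. `p² ∣ n` with `p ≤ (log x)^C`).

* `bilin_row_norm_sum_le`, `bilin_col_norm_sum_le` — `∑_{z ∈ Z} ‖K w₀ z‖ ≤ X`, `∑_{w ∈ W} ‖K w z₀‖ ≤ X`.
* `bilin_rows_norm_sum_le` — `∑_{w ∈ W'} ∑_{z ∈ Z} ‖K w z‖ ≤ #W' · X` for `W' ⊆ W`.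
* `typeII_row_abs_sum_le` — (II) ⇒ `∑_{n ≤ x, x/2 < mn ≤ x} |w(mn)| ≤ x/(log x)^B` for each
  `(x/2)^θ < m ≤ x^{θ+ν}` (`B ≥ 0`).

Def-free. Nothing here proves anything about the Parity summit; helpers for the Type-II region stub of one leaf.
-/

open Finset Literature.NumberTheory.Sieve.FriedlanderIwaniecPrimes

namespace Summit.Parity.GeneralizedHardyLittlewood.FordMaynardSieveConst01651SieveConst01651

variable {ι κ : Type*}

/-- The unimodular "sign" coefficient: `‖conj u / ‖u‖‖ ≤ 1` and `conj u / ‖u‖ * u = ‖u‖`. [folklore] -/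
theorem norm_conj_div_norm_le_one (u : ℂ) : ‖(starRingEnd ℂ u) / (‖u‖ : ℂ)‖ ≤ 1 := by
  rw [norm_div, Complex.norm_conj, Complex.norm_real, Real.norm_eq_abs, abs_of_nonneg (norm_nonneg _)]
  rcases eq_or_ne u 0 with h | h
  · simp [h]
  · rw [div_self (norm_ne_zero_iff.mpr h)]

/-- `conj u / ‖u‖ * u = ‖u‖`. [folklore] -/
theorem conj_div_norm_mul_self (u : ℂ) : (starRingEnd ℂ u) / (‖u‖ : ℂ) * u = (‖u‖ : ℂ) := by
  rcases eq_or_ne u 0 with h | h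
  · simp [h]
  · have hn : (‖u‖ : ℂ) ≠ 0 := by exact_mod_cast norm_ne_zero_iff.mpr h
    rw [div_mul_eq_mul_div, Complex.conj_mul', div_eq_iff hn]
    ring

/-- **Row mass.** If every bilinear form in `K` over `W × Z` with `1`-bounded coefficients is `≤ X`, then for
every `w₀ ∈ W`, `∑_{z ∈ Z} ‖K w₀ z‖ ≤ X` (coefficients `a = 𝟙_{w₀}`, `b(z) = conj K(w₀,z)/‖K(w₀,z)‖`).
[cite: FordMaynard2024PrimeSieves, §1 (II) (arbitrary divisor-bounded coefficients)] -/
theorem bilin_row_norm_sum_le [DecidableEq ι] {K : ι → κ → ℂ} {W : Finset ι} {Z : Finset κ} {X : ℝ}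
    (h : BilinBoundedBy K W Z X) {w₀ : ι} (hw₀ : w₀ ∈ W) :
    ∑ z ∈ Z, ‖K w₀ z‖ ≤ X := by
  have h1 := h (fun w => if w = w₀ then 1 else 0) (fun z => (starRingEnd ℂ (K w₀ z)) / (‖K w₀ z‖ : ℂ))
    (fun w => by split_ifs <;> simp) (fun z => norm_conj_div_norm_le_one _)
  have hsum : ∑ w ∈ W, ∑ z ∈ Z, (if w = w₀ then (1 : ℂ) else 0) *
      ((starRingEnd ℂ (K w₀ z)) / (‖K w₀ z‖ : ℂ)) * K w z = ((∑ z ∈ Z, ‖K w₀ z‖ : ℝ) : ℂ) := by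
    rw [Finset.sum_eq_single_of_mem w₀ hw₀ (fun w _ hw => by simp [hw])]
    push_cast
    refine Finset.sum_congr rfl fun z _ => ?_
    rw [if_pos rfl, one_mul, conj_div_norm_mul_self]
  rw [hsum, Complex.norm_real, Real.norm_eq_abs] at h1
  exact (le_abs_self _).trans h1

/-- **Column mass**: for every `z₀ ∈ Z`, `∑_{w ∈ W} ‖K w z₀‖ ≤ X`.
[cite: FordMaynard2024PrimeSieves, §1 (II) (arbitrary divisor-bounded coefficients)] -/
theorem bilin_col_norm_sum_le [DecidableEq κ] {K : ι → κ → ℂ} {W : Finset ι} {Z : Finset κ} {X : ℝ}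
    (h : BilinBoundedBy K W Z X) {z₀ : κ} (hz₀ : z₀ ∈ Z) :
    ∑ w ∈ W, ‖K w z₀‖ ≤ X := by
  have h1 := h (fun w => (starRingEnd ℂ (K w z₀)) / (‖K w z₀‖ : ℂ)) (fun z => if z = z₀ then 1 else 0)
    (fun w => norm_conj_div_norm_le_one _) (fun z => by split_ifs <;> simp)
  have hsum : ∑ w ∈ W, ∑ z ∈ Z, ((starRingEnd ℂ (K w z₀)) / (‖K w z₀‖ : ℂ)) *
      (if z = z₀ then (1 : ℂ) else 0) * K w z = ((∑ w ∈ W, ‖K w z₀‖ : ℝ) : ℂ) := by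
    push_cast
    refine Finset.sum_congr rfl fun w _ => ?_
    rw [Finset.sum_eq_single_of_mem z₀ hz₀ (fun z _ hz => by simp [hz])]
    rw [if_pos rfl, mul_one, conj_div_norm_mul_self]
  rw [hsum, Complex.norm_real, Real.norm_eq_abs] at h1
  exact (le_abs_self _).trans h1

/-- **Several rows**: `∑_{w ∈ W'} ∑_{z ∈ Z} ‖K w z‖ ≤ #W' · X` for `W' ⊆ W` — useful when only boundedly many
(or `(log x)^{O(1)}` many) small moduli cut out the exceptional set.
[cite: FordMaynard2024PrimeSieves, §1 (II) (arbitrary divisor-bounded coefficients)] -/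
theorem bilin_rows_norm_sum_le [DecidableEq ι] {K : ι → κ → ℂ} {W : Finset ι} {Z : Finset κ} {X : ℝ}
    (h : BilinBoundedBy K W Z X) {W' : Finset ι} (hW' : W' ⊆ W) :
    ∑ w ∈ W', ∑ z ∈ Z, ‖K w z‖ ≤ (W'.card : ℝ) * X := by
  calc ∑ w ∈ W', ∑ z ∈ Z, ‖K w z‖ ≤ ∑ _w ∈ W', X :=
        Finset.sum_le_sum fun w hw => bilin_row_norm_sum_le h (hW' hw)
    _ = (W'.card : ℝ) * X := by rw [Finset.sum_const, nsmul_eq_mul]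

/-- **(II) bounds the `|w|`-mass on the multiples of any single modulus of the Type-II range.** If `w` satisfies
Ford–Maynard's Type-II bound (II) on `((x/2)^θ, x^{θ+ν}]` with exponent `B ≥ 0`, then for every modulus `m` with
`(x/2)^θ < m ≤ x^{θ+ν}` (at `θ = 0`: every `1 < m ≤ x^ν`),
`∑_{n ≤ x, x/2 < mn ≤ x} |w(mn)| ≤ x/(log x)^B` — no sign or size hypothesis on `w`.
[cite: FordMaynard2024PrimeSieves, §1 (II)] -/
theorem typeII_row_abs_sum_le {w : ℕ → ℝ} {x θ ν B : ℝ}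
    (hII : Literature.Barriers.Parity.FordMaynard.TypeII w x θ ν B) (hB : 0 ≤ B) {m : ℕ}
    (hm : m ∈ (Icc 1 ⌊x ^ (θ + ν)⌋₊).filter (fun m : ℕ => (x / 2) ^ θ < (m : ℝ))) :
    ∑ n ∈ (Icc 1 ⌊x⌋₊).filter (fun n : ℕ => x / 2 < (m * n : ℝ) ∧ (m * n : ℝ) ≤ x), |w (m * n)| ≤
      x / Real.log x ^ B := by
  have h0 := bilinBoundedBy_of_typeII_zero hII hB
  have h1 := bilin_row_norm_sum_le h0 hm
  rw [Finset.sum_filter]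
  refine le_of_eq_of_le (Finset.sum_congr rfl fun n _ => ?_) h1
  split_ifs with hmn
  · rw [Complex.norm_real, Real.norm_eq_abs]
  · rw [norm_zero]

end Summit.Parity.GeneralizedHardyLittlewood.FordMaynardSieveConst01651SieveConst01651
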